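import Summits.HodgeConjecture.CorCM.Census.DicyclicTwistModel

/-!
# The quartic inversion twists `Dic(ℤ/4 × B)` and `D(ℤ/4 × B)` over `ℤ/2 × B`, I: the model — quadruples of slice labels, three motions

COR-CM (cell `pub-hodgecm2`, stage 2 of the Hodge ladder), count-neutral KERNEL COMBINATORICS by the binder seat b23 (gen 44; claim
QUARTIC-INVERSION, the successor column of the dicyclic column `Census/DicyclicTwist*` of gens 42–43).  Bookkeeping definitions with bodies +
theorems on top of seat b09's representative-free slice `Census/OddSliceFacesModel.lean` (`Ty A`, `tw`) and part I of the dicyclic lane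
`Census/DicyclicTwistModel.lean` (`Ty₂ A`, `rev`, `twH`), used BY NAME; no `decide` table, no certificate, no named fact, no geometry, no `sorry`.
`Interfaces.lean` (C1), every E term, B01, `Transposition/*`, `PortJoin/*` untouched.
HONEST FRAMING: `HC_CM` is NOT proved, here or anywhere in the tree; nothing here is a period, a count of record or a headline.

THE GROUPS.  `B` is a finite abelian group (written `A` in the code, as in the slice files), `H₀ = ℤ/2 × B` with `c = (1,0)`, and for
`ζ ∈ ℤ/2` the group
  `G_ζ(B) = ⟨H₀, y, t | y h y⁻¹ = h⁻¹, t h t⁻¹ = h (h ∈ H₀), y² = (ζ, 0), t² = c, t y t⁻¹ = c·y⟩`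
of order `8|B|`: the element `t` generates with `H₀` the abelian group `H = ⟨H₀, t⟩ ≅ ℤ/4 × B` (`t² = c`: the QUARTIC TWIST of seat b09's
`Census/QuarticTwist*`, `c = (2,0)` a square), and `y` inverts `H` (`y t y⁻¹ = c t = t⁻¹`), with `y² = c` for `ζ = 1` and `y² = 1` for `ζ = 0`:
  **`G₁(B) = Dic(ℤ/4 × B, c)`** — the generalised dicyclic group of `ℤ/4 × B` at `c` (`B = 1`: the quaternion group `Q₈`; `B = ℤ/m`, `m` odd: the
  dicyclic group `Dic_{2m}` of order `8m`, e.g. `Dic₆` of lit-andre-3's atlas row `Census/TwentyFourDicyclic*`; `B = ℤ/2`: `Q₈ × ℤ/2`), and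
  **`G₀(B) = D(ℤ/4 × B) = (ℤ/4 × B) ⋊ ℤ/2`** — the twisted dihedral group (`B = 1`: `D₄` with `c = r²`, the Galois group of the closure of a
  non-Galois quartic CM field; `B = ℤ/m`, `m` odd: the dihedral group `D_{4m}` of order `8m` with `c = r^{2m}`).
In both, `c` is a central involution lying in the Frattini subgroup (the twisted column of the census), and `M = H₀ ⊔ y H₀` is a subgroup of index
two met in earlier columns (`ζ = 1`: `Dic(ℤ/2 × B, c)`, gens 42–43; `ζ = 0`: `ℤ/2 × Dih(B)`, complemented, gen 40).

THE MODEL.  By the index-two descent (`Census/IndexTwoDescent*`, gen 41) applied twice (`G ⊃ M ⊃ H₀`), an abstract CM type of `(G_ζ(B), c)` is a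
QUADRUPLE of slice labels, which we keep as a pair of pairs `Θ = ((ψ₀, ψ₁), (ψ₂, ψ₃)) ∈ Ty₄ B = Ty₂ B × Ty₂ B` (`ψ_i : B → ℤ/2`; coset order
`H₀, yH₀, tH₀, tyH₀`).  The three motions (§1):
* `twH₄ (a,s)` — b09's twist `ψ ↦ ψ(· + s) + a` on all four coordinates (`h ∈ H₀`);
* **`twY ζ ((ψ₀,ψ₁),(ψ₂,ψ₃)) = ((ψ₁(−·), ψ₀(−·) + ζ), (ψ₃(−·), ψ₂(−·) + ζ))`** — the swap-twist of gen 42 (`ζ = 1`) resp. its square-one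
  variant (`ζ = 0`) on both pairs (`y` inverts `H₀`, `y² = (ζ,0)`);
* **`twT ((ψ₀,ψ₁),(ψ₂,ψ₃)) = ((ψ₂, ψ₃ + 1), (ψ₀ + 1, ψ₁))`** — base change along `t` (`t` centralises `H₀`, `t² = c`, `t⁻¹ y t = c·y`:
  `conjPull (ψ₂,ψ₃) = (ψ₂, ψ₃+1)`, `pushTwist (ψ₀,ψ₁) = (ψ₀+1, ψ₁)` in the language of `Census/IndexTwoDescentBlocks.lean`).
The defining relations hold on labels (§1: `twY_twY : twY² = twH₄ (ζ,0)`, `twT_twT : twT² = twH₄ c`, `twY_twH₄`, `twT_twH₄`,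
**`twY_twT : twY ∘ twT = twH₄ c ∘ twT ∘ twY`**), so the translates `translH₄`, `translY`, `translT` of exponent vectors (§2) generate the action of
`ℤ[G_ζ(B)]` on `ℤ[Ty₄ B]`.  Part II (`Census/QuarticInversionHodge.lean`) adds the marginals, the Hodge lattice and the pairs.  All [folklore]
(Pohlmann's dictionary [Pohlmann1968, Thm 1] along an iterated index-two descent).

## References
* [Pohlmann1968] H. Pohlmann, Algebraic cycles on abelian varieties of complex multiplication type, Ann. of Math. 88 (1968), Thm 1.
* [Milne1999] J. S. Milne, Lefschetz motives and the Tate conjecture, Compositio Math. 117 (1999), Prop. 2.1, p. 54.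
-/

namespace Summit.HodgeConjecture.CorCM.Census.QuarticInversion

open Finset
open Summit.HodgeConjecture.CorCM.Census.OddSliceFacesModel
open Summit.HodgeConjecture.CorCM.Census.DicyclicTwist (Ty₂ rev rev_rev rev_add_one rev_add rev_tw twH twH_twH twH_zero twH_one_zero)

/-! ## §1 Labels and the three motions -/

section Labels

variable (A : Type) [AddCommGroup A] [DecidableEq A]

/-- The labels of `(G_ζ(B), c)`: quadruples of slice labels, kept as pairs of pairs `((ψ₀, ψ₁), (ψ₂, ψ₃))`. [folklore] -/
abbrev Ty₄ : Type := Ty₂ A × Ty₂ A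

/-- The constant label `s ↦ ζ`. [folklore] -/
def cst (ζ : ZMod 2) : Ty A := fun _ => ζ

omit [AddCommGroup A] [DecidableEq A] in
/-- `cst 1 = 1`. [folklore] -/
@[simp] theorem cst_one : cst A 1 = 1 := rfl

omit [AddCommGroup A] [DecidableEq A] in
/-- `cst 0 = 0`. [folklore] -/
@[simp] theorem cst_zero : cst A 0 = 0 := rfl

omit [AddCommGroup A] [DecidableEq A] in
/-- `cst ζ + cst ζ = 0`. [folklore] -/
theorem cst_add_cst (ζ : ZMod 2) : cst A ζ + cst A ζ = 0 := by
  funext s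
  have key : ∀ u : ZMod 2, u + u = 0 := by decide
  exact key ζ

omit [DecidableEq A] in
/-- `rev (cst ζ) = cst ζ`. [folklore] -/
@[simp] theorem rev_cst (ζ : ZMod 2) : rev A (cst A ζ) = cst A ζ := rfl

omit [DecidableEq A] in
/-- Twisting a constant-shifted label. [folklore] -/
theorem tw_add_cst (g : ZMod 2 × A) (ψ : Ty A) (ζ : ZMod 2) : tw A g (ψ + cst A ζ) = tw A g ψ + cst A ζ := by
  funext s
  simp only [tw, cst, Pi.add_apply]
  ring

omit [DecidableEq A] in
/-- Twisting by `(ζ, 0)` adds the constant `ζ`. [folklore] -/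
theorem tw_cst_zero (ζ : ZMod 2) (ψ : Ty A) : tw A (ζ, 0) ψ = ψ + cst A ζ := by
  funext s; simp [tw, cst]

/-- **The swap-twist with square class `ζ`**: `twX' ζ (ψ₀, ψ₁) = (ψ₁(−·), ψ₀(−·) + ζ)` (`ζ = 1`: gen 42's `twX`). [folklore] -/
def twX' (ζ : ZMod 2) (Ψ : Ty₂ A) : Ty₂ A := (rev A Ψ.2, rev A Ψ.1 + cst A ζ)

/-- Its inverse: `(ψ₀, ψ₁) ↦ (ψ₁(−·) + ζ, ψ₀(−·))`. [folklore] -/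
def twX'inv (ζ : ZMod 2) (Ψ : Ty₂ A) : Ty₂ A := (rev A Ψ.2 + cst A ζ, rev A Ψ.1)

omit [DecidableEq A] in
/-- `twX'inv ∘ twX' = id`. [folklore] -/
@[simp] theorem twX'inv_twX' (ζ : ZMod 2) (Ψ : Ty₂ A) : twX'inv A ζ (twX' A ζ Ψ) = Ψ := by
  obtain ⟨ψ₀, ψ₁⟩ := Ψ
  simp only [twX', twX'inv, rev_add, rev_rev, rev_cst, add_assoc, cst_add_cst, add_zero]

omit [DecidableEq A] in
/-- `twX' ∘ twX'inv = id`. [folklore] -/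
@[simp] theorem twX'_twX'inv (ζ : ZMod 2) (Ψ : Ty₂ A) : twX' A ζ (twX'inv A ζ Ψ) = Ψ := by
  obtain ⟨ψ₀, ψ₁⟩ := Ψ
  simp only [twX', twX'inv, rev_add, rev_rev, rev_cst, add_assoc, cst_add_cst, add_zero]

omit [DecidableEq A] in
/-- **`y² = (ζ, 0)` on pairs**: `twX' ζ ∘ twX' ζ = twH (ζ, 0)`. [folklore] -/
theorem twX'_twX' (ζ : ZMod 2) (Ψ : Ty₂ A) : twX' A ζ (twX' A ζ Ψ) = twH A (ζ, 0) Ψ := by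
  obtain ⟨ψ₀, ψ₁⟩ := Ψ
  simp only [twX', twH, rev_add, rev_rev, rev_cst, tw_cst_zero]

omit [DecidableEq A] in
/-- `twX' ζ ∘ twH (a,s) = twH (a,−s) ∘ twX' ζ`. [folklore] -/
theorem twX'_twH (ζ : ZMod 2) (g : ZMod 2 × A) (Ψ : Ty₂ A) :
    twX' A ζ (twH A g Ψ) = twH A (g.1, -g.2) (twX' A ζ Ψ) := by
  obtain ⟨ψ₀, ψ₁⟩ := Ψ
  simp only [twX', twH, rev_tw, tw_add_cst]

/-- **The diagonal motion** of `h ∈ H₀` on quadruples. [folklore] -/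
def twH₄ (g : ZMod 2 × A) (Θ : Ty₄ A) : Ty₄ A := (twH A g Θ.1, twH A g Θ.2)

/-- **The motion of `y`**: the swap-twist with square class `ζ` on both pairs. [folklore] -/
def twY (ζ : ZMod 2) (Θ : Ty₄ A) : Ty₄ A := (twX' A ζ Θ.1, twX' A ζ Θ.2)

/-- The motion of `y⁻¹`. [folklore] -/
def twYinv (ζ : ZMod 2) (Θ : Ty₄ A) : Ty₄ A := (twX'inv A ζ Θ.1, twX'inv A ζ Θ.2)

/-- **The motion of `t`**: `((ψ₀,ψ₁),(ψ₂,ψ₃)) ↦ ((ψ₂, ψ₃ + 1), (ψ₀ + 1, ψ₁))`. [folklore] -/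
def twT (Θ : Ty₄ A) : Ty₄ A := ((Θ.2.1, Θ.2.2 + 1), (Θ.1.1 + 1, Θ.1.2))

/-- The motion of `t⁻¹`: `((ψ₀,ψ₁),(ψ₂,ψ₃)) ↦ ((ψ₂ + 1, ψ₃), (ψ₀, ψ₁ + 1))`. [folklore] -/
def twTinv (Θ : Ty₄ A) : Ty₄ A := ((Θ.2.1 + 1, Θ.2.2), (Θ.1.1, Θ.1.2 + 1))

omit [DecidableEq A] in
/-- Composition of diagonal motions. [folklore] -/
theorem twH₄_twH₄ (g h : ZMod 2 × A) (Θ : Ty₄ A) : twH₄ A g (twH₄ A h Θ) = twH₄ A (h + g) Θ := by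
  simp only [twH₄, twH_twH]

omit [DecidableEq A] in
/-- The diagonal motion by `0` is the identity. [folklore] -/
@[simp] theorem twH₄_zero (Θ : Ty₄ A) : twH₄ A 0 Θ = Θ := by
  simp only [twH₄, twH_zero]

omit [DecidableEq A] in
/-- The diagonal motion by `c = (1,0)` conjugates all four coordinates. [folklore] -/
theorem twH₄_one_zero (Θ : Ty₄ A) : twH₄ A (1, 0) Θ = ((Θ.1.1 + 1, Θ.1.2 + 1), (Θ.2.1 + 1, Θ.2.2 + 1)) := by
  simp only [twH₄, twH_one_zero]

omit [DecidableEq A] in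
/-- `y⁻¹ y = 1` on labels. [folklore] -/
@[simp] theorem twYinv_twY (ζ : ZMod 2) (Θ : Ty₄ A) : twYinv A ζ (twY A ζ Θ) = Θ := by
  simp only [twY, twYinv, twX'inv_twX']

omit [DecidableEq A] in
/-- `y y⁻¹ = 1` on labels. [folklore] -/
@[simp] theorem twY_twYinv (ζ : ZMod 2) (Θ : Ty₄ A) : twY A ζ (twYinv A ζ Θ) = Θ := by
  simp only [twY, twYinv, twX'_twX'inv]

omit [DecidableEq A] in
/-- **`y² = (ζ, 0)`**: `twY ζ ∘ twY ζ = twH₄ (ζ, 0)`. [folklore] -/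
theorem twY_twY (ζ : ZMod 2) (Θ : Ty₄ A) : twY A ζ (twY A ζ Θ) = twH₄ A (ζ, 0) Θ := by
  simp only [twY, twH₄, twX'_twX']

omit [DecidableEq A] in
/-- **`y h = h⁻¹ y` on `H₀`**: `twY ζ ∘ twH₄ (a,s) = twH₄ (a,−s) ∘ twY ζ`. [folklore] -/
theorem twY_twH₄ (ζ : ZMod 2) (g : ZMod 2 × A) (Θ : Ty₄ A) : twY A ζ (twH₄ A g Θ) = twH₄ A (g.1, -g.2) (twY A ζ Θ) := by
  simp only [twY, twH₄, twX'_twH]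

omit [AddCommGroup A] [DecidableEq A] in
/-- `ψ + 1 + 1 = ψ` in the form `(ψ + 1) + 1`. [folklore] -/
private theorem add_one_add_one' (ψ : Ty A) : ψ + 1 + 1 = ψ := add_one_add_one A ψ

omit [AddCommGroup A] [DecidableEq A] in
/-- `t⁻¹ t = 1` on labels. [folklore] -/
@[simp] theorem twTinv_twT (Θ : Ty₄ A) : twTinv A (twT A Θ) = Θ := by
  obtain ⟨⟨ψ₀, ψ₁⟩, ⟨ψ₂, ψ₃⟩⟩ := Θ
  simp only [twT, twTinv, add_one_add_one']

omit [AddCommGroup A] [DecidableEq A] in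
/-- `t t⁻¹ = 1` on labels. [folklore] -/
@[simp] theorem twT_twTinv (Θ : Ty₄ A) : twT A (twTinv A Θ) = Θ := by
  obtain ⟨⟨ψ₀, ψ₁⟩, ⟨ψ₂, ψ₃⟩⟩ := Θ
  simp only [twT, twTinv, add_one_add_one']

omit [DecidableEq A] in
/-- **`t² = c`**: `twT ∘ twT = twH₄ (1, 0)`. [folklore] -/
theorem twT_twT (Θ : Ty₄ A) : twT A (twT A Θ) = twH₄ A (1, 0) Θ := by
  obtain ⟨⟨ψ₀, ψ₁⟩, ⟨ψ₂, ψ₃⟩⟩ := Θ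
  simp only [twT, twH₄_one_zero]

omit [DecidableEq A] in
/-- **`t` centralises `H₀`**: `twT ∘ twH₄ g = twH₄ g ∘ twT`. [folklore] -/
theorem twT_twH₄ (g : ZMod 2 × A) (Θ : Ty₄ A) : twT A (twH₄ A g Θ) = twH₄ A g (twT A Θ) := by
  obtain ⟨⟨ψ₀, ψ₁⟩, ⟨ψ₂, ψ₃⟩⟩ := Θ
  simp only [twT, twH₄, twH, tw_add_one]

omit [DecidableEq A] in
/-- **`t⁻¹ y t = c y`**: `twY ζ ∘ twT = twH₄ (1,0) ∘ twT ∘ twY ζ` (base changes compose contravariantly). [folklore] -/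
theorem twY_twT (ζ : ZMod 2) (Θ : Ty₄ A) : twY A ζ (twT A Θ) = twH₄ A (1, 0) (twT A (twY A ζ Θ)) := by
  obtain ⟨⟨ψ₀, ψ₁⟩, ⟨ψ₂, ψ₃⟩⟩ := Θ
  rw [twH₄_one_zero]
  refine Prod.ext (Prod.ext ?_ ?_) (Prod.ext ?_ ?_)
  · show rev A (ψ₃ + 1) = rev A ψ₃ + 1
    exact rev_add_one A ψ₃
  · show rev A ψ₂ + cst A ζ = rev A ψ₂ + cst A ζ + 1 + 1
    rw [add_one_add_one']
  · show rev A ψ₁ = rev A ψ₁ + 1 + 1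
    rw [add_one_add_one']
  · show rev A (ψ₀ + 1) + cst A ζ = rev A ψ₀ + cst A ζ + 1
    rw [rev_add_one, add_right_comm]

/-- The diagonal motion as a permutation of the labels. [folklore] -/
def twH₄Equiv (g : ZMod 2 × A) : Ty₄ A ≃ Ty₄ A where
  toFun := twH₄ A g
  invFun := twH₄ A (-g)
  left_inv Θ := by rw [twH₄_twH₄, add_neg_cancel, twH₄_zero]
  right_inv Θ := by rw [twH₄_twH₄, neg_add_cancel, twH₄_zero]

/-- The motion of `y` as a permutation of the labels. [folklore] -/
def twYEquiv (ζ : ZMod 2) : Ty₄ A ≃ Ty₄ A where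
  toFun := twY A ζ
  invFun := twYinv A ζ
  left_inv := twYinv_twY A ζ
  right_inv := twY_twYinv A ζ

/-- The motion of `t` as a permutation of the labels. [folklore] -/
def twTEquiv : Ty₄ A ≃ Ty₄ A where
  toFun := twT A
  invFun := twTinv A
  left_inv := twTinv_twT A
  right_inv := twT_twTinv A

/-! ## §2 Translates of exponent vectors -/

/-- Translate of an exponent vector by `h ∈ H₀`: `(h·v)(Θ) = v(h⁻¹ Θ)`. [folklore] -/
def translH₄ (g : ZMod 2 × A) (v : Ty₄ A → ℤ) : Ty₄ A → ℤ := fun Θ => v (twH₄ A (-g) Θ)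

/-- Translate of an exponent vector by `y`. [folklore] -/
def translY (ζ : ZMod 2) (v : Ty₄ A → ℤ) : Ty₄ A → ℤ := fun Θ => v (twYinv A ζ Θ)

/-- Translate of an exponent vector by `t`. [folklore] -/
def translT (v : Ty₄ A → ℤ) : Ty₄ A → ℤ := fun Θ => v (twTinv A Θ)

/-- Translation by `h` as a `ℤ`-linear map. [folklore] -/
def translH₄Hom (g : ZMod 2 × A) : (Ty₄ A → ℤ) →ₗ[ℤ] (Ty₄ A → ℤ) where
  toFun := translH₄ A g
  map_add' _ _ := rfl
  map_smul' _ _ := rfl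

/-- Translation by `y` as a `ℤ`-linear map. [folklore] -/
def translYHom (ζ : ZMod 2) : (Ty₄ A → ℤ) →ₗ[ℤ] (Ty₄ A → ℤ) where
  toFun := translY A ζ
  map_add' _ _ := rfl
  map_smul' _ _ := rfl

/-- Translation by `t` as a `ℤ`-linear map. [folklore] -/
def translTHom : (Ty₄ A → ℤ) →ₗ[ℤ] (Ty₄ A → ℤ) where
  toFun := translT A
  map_add' _ _ := rfl
  map_smul' _ _ := rfl

omit [DecidableEq A] in
/-- `translH₄Hom` is `translH₄`. [folklore] -/
@[simp] theorem translH₄Hom_apply (g : ZMod 2 × A) (v : Ty₄ A → ℤ) : translH₄Hom A g v = translH₄ A g v := rfl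

omit [DecidableEq A] in
/-- `translYHom` is `translY`. [folklore] -/
@[simp] theorem translYHom_apply (ζ : ZMod 2) (v : Ty₄ A → ℤ) : translYHom A ζ v = translY A ζ v := rfl

omit [AddCommGroup A] [DecidableEq A] in
/-- `translTHom` is `translT`. [folklore] -/
@[simp] theorem translTHom_apply (v : Ty₄ A → ℤ) : translTHom A v = translT A v := rfl

end Labels

end Summit.HodgeConjecture.CorCM.Census.QuarticInversion
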